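import Literature.AlgebraicGeometry.Hu2025.Proofs.S07GammaSchemes.Lem73BaseMaximality
import Literature.RingTheory.MvPolynomial.GenericTwoByNMinors
import HarnessLib

/-!
# Hu 2025 (arXiv:2507.21400v1) §7.1–§7.2 on the toy chart `n = 5`, `m = (123)`: the SEGRE-CONE case
# `Γ = {x₁₄₅, x₂₄₅, x₃₄₅}` — `Z_Γ` is integral (the J1 hypothesis «Assume that Z_Γ is integral» in the typed form
# `ZGammaIntegral`), and here the `k = 0` data `Γ̃⁰_𝐔 := Γ` of C57L151 DOES satisfy the maximality clause

**Honest framing (D-0012/D-0089).** Kernel facts about TYPED decls (row 109: `R109aGamma.lean`, `R109bFTransforms.lean`)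
on ONE toy instance, taking no side on the manuscript [Hu2025] (arXiv:2507.21400v1, `paper:arxiv-2507.21400`, UNREFEREED,
under adjudication at rung M-Hu-min of the campaign `res-hironaka`); nothing of [Hu2025] is asserted; AI proving is
weaker than expert review. Provenance: res-type-016 (typer of record of row 109). Companion of
`Lem73BaseMaximality.lean` (same nine variables `0 ↦ x₁₂₄, 1 ↦ x₁₂₅, 2 ↦ x₁₃₄, 3 ↦ x₁₃₅, 4 ↦ x₁₄₅, 5 ↦ x₂₃₄, 6 ↦ x₂₃₅,
7 ↦ x₂₄₅, 8 ↦ x₃₄₅`, same `𝔉 = {F̄₁, F̄₂, F̄₃}`). For `Γ = {x₁₄₅, x₂₄₅, x₃₄₅}` (the locus the index record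
`Literature/AlgebraicGeometry/Hu2025/EllChartSegreJacobian.lean` calls the Segre cone):
* `gammaWpIdeal_eq_comap` — `I_{℘,Γ}` is the pre-image of the ideal `I₂` of `2 × 2` minors of the generic `2 × 3` matrix
  `[[x₁₂₄, x₁₃₄, x₂₃₄], [x₁₂₅, x₁₃₅, x₂₃₅]]` (tree `Literature.RingTheory.MvPolynomial.twoMinorIdeal ℚ 3`) under the
  substitution killing `x₁₄₅, x₂₄₅, x₃₄₅` (modulo `Γ`, `F̄ₖ ≡ −(minor)`);
* `zGammaIntegral_segre` — hence `Z_Γ` is integral (`I₂` is prime: tree `isPrime_twoMinorIdeal`, Bruns–Herzog Thm. 7.3.6);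
* `gamma0Maximal_segre` — `{y | x_y ∈ I_{℘,Γ}} = Γ` (no variable lies in `I₂`), so for THIS `Γ` the `k = 0` data
  `Γ̃⁰_𝐔 := Γ` satisfies item (1) AND the maximality clause (contrast: `Lem73BaseToy.not_lem7_3_1max_D0` for
  `Γ = {x₁₂₄, x₁₃₄}`) — the clause's truth at `k = 0` depends on `Γ`.

## References
* [Hu2025] Y. Hu, arXiv:2507.21400v1 (2025), Def. 7.1 C57L9–L24 (p.128); Lem. 7.3 C57L79–L153 (p.129–130) — loci of the
  typed definitions only (unrefereed manuscript under adjudication).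
* [BrunsHerzog1998] W. Bruns, J. Herzog, *Cohen–Macaulay rings*, Thm. 7.3.6 (`r = 1`) — via the tree file
  `Literature/RingTheory/MvPolynomial/GenericTwoByNMinors.lean`.
-/

noncomputable section

namespace Literature.AlgebraicGeometry.Hu2025.Statements.S07GammaSchemes

namespace SegreConeToy

open MvPolynomial GammaTransformChart Lem73BaseToy Literature.RingTheory.MvPolynomial
  Literature.RingTheory.MvPolynomial.GenericTwoByNMinors

/-- `Γ = {x₁₄₅, x₂₄₅, x₃₄₅}` (indices `4, 7, 8`). [cite: Hu2025, Def. 7.1 C57L9–L24; p.128 (unrefereed manuscript under adjudication — kernel support on a toy instance, nothing of the manuscript asserted)] -/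
def Γs : Finset (Fin 9) := {4, 7, 8}

/-- `I_{℘,Γ}` for the Segre-cone `Γ`. [cite: Hu2025, Def. 7.1 C57L14–L21; p.128 (unrefereed manuscript under adjudication — kernel support on a toy instance, nothing asserted)] -/
abbrev Is : Ideal R := gammaWpIdeal 𝔉 (Γs : Set (Fin 9))

/-- The substitution killing `Γ` and renaming the six remaining variables as the generic `2 × 3` matrix
`[[x₁₂₄, x₁₃₄, x₂₃₄], [x₁₂₅, x₁₃₅, x₂₃₅]]` (first row = tree indices `castAdd 3 i`, second row = `natAdd 3 i`).
[cite: Hu2025, Def. 7.1 C57L33–L43 «coordinate subspace 𝐔_Γ»; p.128 (unrefereed manuscript under adjudication — kernel support on a toy instance, nothing asserted)] -/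
def gs (i : Fin 9) : MvPolynomial (Fin (3 + 3)) ℚ :=
  if i = 0 then X (Fin.castAdd 3 0) else if i = 2 then X (Fin.castAdd 3 1) else if i = 5 then X (Fin.castAdd 3 2)
  else if i = 1 then X (Fin.natAdd 3 0) else if i = 3 then X (Fin.natAdd 3 1) else if i = 6 then X (Fin.natAdd 3 2)
  else 0

/-- The section of `gs`. [cite: Hu2025, Def. 7.1 C57L33–L43; p.128 (unrefereed manuscript under adjudication — kernel support on a toy instance, nothing asserted)] -/
def ss : Fin (3 + 3) → R :=
  Fin.append (fun i : Fin 3 => if i = 0 then X 0 else if i = 1 then X 2 else X 5)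
    (fun i : Fin 3 => if i = 0 then X 1 else if i = 1 then X 3 else X 6)

/-- `φs : R → ℚ[2 × 3 matrix]`. [cite: Hu2025, Def. 7.1 C57L33–L43; p.128 (unrefereed manuscript under adjudication — kernel support on a toy instance, nothing asserted)] -/
def φs : R →ₐ[ℚ] MvPolynomial (Fin (3 + 3)) ℚ := aeval gs

/-- `ψs`, the section of `φs`. [cite: Hu2025, Def. 7.1 C57L33–L43; p.128 (unrefereed manuscript under adjudication — kernel support on a toy instance, nothing asserted)] -/
def ψs : MvPolynomial (Fin (3 + 3)) ℚ →ₐ[ℚ] R := aeval ss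

/-- `x₁₄₅, x₂₄₅, x₃₄₅ ∈ I_{℘,Γ}`. [cite: Hu2025, Def. 7.1 C57L14–L21; p.128 (unrefereed manuscript under adjudication — kernel support on a toy instance, nothing asserted)] -/
theorem X_mem_Is {y : Fin 9} (hy : y ∈ Γs) : (X y : R) ∈ Is :=
  Ideal.mem_sup_left (Ideal.subset_span ⟨y, Finset.mem_coe.mpr hy, rfl⟩)

/-- `F̄ₖ ∈ I_{℘,Γ}`. [cite: Hu2025, Def. 7.1 C57L14–L21; p.128 (unrefereed manuscript under adjudication — kernel support on a toy instance, nothing asserted)] -/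
theorem rels_mem_Is (j : Fin 3) : rels j ∈ Is := Ideal.mem_sup_right (Ideal.subset_span ⟨j, rfl⟩)

/-- Every variable is congruent to the section of its image modulo `I_{℘,Γ}`. [cite: Hu2025, Def. 7.1 C57L33–L43; p.128 (unrefereed manuscript under adjudication — kernel support on a toy instance, nothing asserted)] -/
theorem X_sub_section_mem_Is (i : Fin 9) : (X i : R) - ψs (φs (X i)) ∈ Is := by
  have h4 : (X 4 : R) ∈ Is := X_mem_Is (by decide)
  have h7 : (X 7 : R) ∈ Is := X_mem_Is (by decide)
  have h8 : (X 8 : R) ∈ Is := X_mem_Is (by decide)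
  fin_cases i <;> simp [φs, ψs, gs, ss, Fin.append, Fin.addCases, h4, h7, h8]

/-- Hence every polynomial is congruent to the section of its image modulo `I_{℘,Γ}`. [cite: Hu2025, Def. 7.1 C57L33–L43; p.128 (unrefereed manuscript under adjudication — kernel support on a toy instance, nothing asserted)] -/
theorem sub_section_mem_Is (f : R) : f - ψs (φs f) ∈ Is := by
  have key : (Ideal.Quotient.mkₐ ℚ Is).comp (ψs.comp φs) = Ideal.Quotient.mkₐ ℚ Is := by
    apply MvPolynomial.algHom_ext
    intro i
    simp only [AlgHom.comp_apply, Ideal.Quotient.mkₐ_eq_mk]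
    rw [Ideal.Quotient.eq]
    simpa using Is.neg_mem (X_sub_section_mem_Is i)
  have := congrArg (fun h : R →ₐ[ℚ] R ⧸ Is => h f) key
  simp only [AlgHom.comp_apply, Ideal.Quotient.mkₐ_eq_mk] at this
  rw [Ideal.Quotient.eq] at this
  simpa using Is.neg_mem this

/-- `φs(F̄ₖ)` lies in the minors ideal `I₂` (it is `−(minor)`). [cite: Hu2025, Def. 3.4 C18L21–L25 / Def. 7.1; p.39–40, p.128 (unrefereed manuscript under adjudication — kernel support on a toy instance, nothing asserted)] -/
theorem φs_rels_mem (j : Fin 3) : φs (rels j) ∈ twoMinorIdeal ℚ 3 := by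
  have m01 : φs F1 = -Pluecker.minor ℚ 3 (Pluecker.pr 0 1 (by decide)) := by
    simp [F1, φs, gs, Pluecker.minor]; ring
  have m02 : φs F2 = -Pluecker.minor ℚ 3 (Pluecker.pr 0 2 (by decide)) := by
    simp [F2, φs, gs, Pluecker.minor]; ring
  have m12 : φs F3 = -Pluecker.minor ℚ 3 (Pluecker.pr 1 2 (by decide)) := by
    simp [F3, φs, gs, Pluecker.minor]; ring
  fin_cases j
  · simpa [rels, m01] using (twoMinorIdeal ℚ 3).neg_mem (Ideal.subset_span ⟨_, rfl⟩)
  · simpa [rels, m02] using (twoMinorIdeal ℚ 3).neg_mem (Ideal.subset_span ⟨_, rfl⟩)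
  · simpa [rels, m12] using (twoMinorIdeal ℚ 3).neg_mem (Ideal.subset_span ⟨_, rfl⟩)

/-- The section carries every minor into `I_{℘,Γ}`: `ψs [i j] = x_Γ-variable − F̄ₖ`. [cite: Hu2025, Def. 3.4 C18L21–L25 / Def. 7.1; p.39–40, p.128 (unrefereed manuscript under adjudication — kernel support on a toy instance, nothing asserted)] -/
theorem ψs_minor_mem (s : Pluecker.Pair 3) : ψs (Pluecker.minor ℚ 3 s) ∈ Is := by
  have h4 : (X 4 : R) ∈ Is := X_mem_Is (by decide)
  have h7 : (X 7 : R) ∈ Is := X_mem_Is (by decide)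
  have h8 : (X 8 : R) ∈ Is := X_mem_Is (by decide)
  have e01 : ψs (Pluecker.minor ℚ 3 (Pluecker.pr 0 1 (by decide))) = X 4 - F1 := by
    simp [F1, ψs, ss, Pluecker.minor, Fin.append, Fin.addCases]; ring
  have e02 : ψs (Pluecker.minor ℚ 3 (Pluecker.pr 0 2 (by decide))) = X 7 - F2 := by
    simp [F2, ψs, ss, Pluecker.minor, Fin.append, Fin.addCases]; ring
  have e12 : ψs (Pluecker.minor ℚ 3 (Pluecker.pr 1 2 (by decide))) = X 8 - F3 := by
    simp [F3, ψs, ss, Pluecker.minor, Fin.append, Fin.addCases]; ring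
  obtain ⟨⟨i, j⟩, hij⟩ := s
  fin_cases i <;> fin_cases j <;> simp (config := { decide := true }) at hij
  · change ψs (Pluecker.minor ℚ 3 (Pluecker.pr 0 1 (by decide))) ∈ Is
    rw [e01]; exact Is.sub_mem h4 F1_mem'
  · change ψs (Pluecker.minor ℚ 3 (Pluecker.pr 0 2 (by decide))) ∈ Is
    rw [e02]; exact Is.sub_mem h7 F2_mem'
  · change ψs (Pluecker.minor ℚ 3 (Pluecker.pr 1 2 (by decide))) ∈ Is
    rw [e12]; exact Is.sub_mem h8 F3_mem'
where
  /-- `F̄₁ ∈ I_{℘,Γ}`. [cite: Hu2025, Def. 7.1 C57L14–L21; p.128 (unrefereed manuscript under adjudication — kernel support, nothing asserted)] -/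
  F1_mem' : F1 ∈ Is := by simpa [rels] using rels_mem_Is 0
  /-- `F̄₂ ∈ I_{℘,Γ}`. [cite: Hu2025, Def. 7.1 C57L14–L21; p.128 (unrefereed manuscript under adjudication — kernel support, nothing asserted)] -/
  F2_mem' : F2 ∈ Is := by simpa [rels] using rels_mem_Is 1
  /-- `F̄₃ ∈ I_{℘,Γ}`. [cite: Hu2025, Def. 7.1 C57L14–L21; p.128 (unrefereed manuscript under adjudication — kernel support, nothing asserted)] -/
  F3_mem' : F3 ∈ Is := by simpa [rels] using rels_mem_Is 2

/-- **`I_{℘,Γ} = φs⁻¹(I₂)`** for the Segre-cone `Γ`. [cite: Hu2025, Def. 7.1 C57L14–L24; p.128 (unrefereed manuscript under adjudication — kernel support on a toy instance, nothing of the manuscript asserted)] -/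
theorem gammaWpIdeal_eq_comap : Is = (twoMinorIdeal ℚ 3).comap (φs : R →+* MvPolynomial (Fin (3 + 3)) ℚ) := by
  apply le_antisymm
  · apply sup_le
    · rw [gammaIdeal, Ideal.span_le]
      rintro _ ⟨y, hy, rfl⟩
      have hy' : y = 4 ∨ y = 7 ∨ y = 8 := by simpa [Γs] using hy
      rw [SetLike.mem_coe, Ideal.mem_comap]
      rcases hy' with rfl | rfl | rfl <;> simp [φs, gs]
    · rw [Ideal.span_le]
      rintro _ ⟨j, rfl⟩
      exact φs_rels_mem j
  · intro f hf
    rw [Ideal.mem_comap] at hf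
    have h1 := sub_section_mem_Is f
    have h2 : ψs (φs f) ∈ Is := by
      have : (twoMinorIdeal ℚ 3).map (ψs : MvPolynomial (Fin (3 + 3)) ℚ →+* R) ≤ Is := by
        rw [twoMinorIdeal, Ideal.map_span, Ideal.span_le]
        rintro _ ⟨_, ⟨s, rfl⟩, rfl⟩
        exact ψs_minor_mem s
      exact this (Ideal.mem_map_of_mem _ hf)
    simpa using Is.add_mem h1 h2

/-- **`Z_Γ` is integral for the Segre-cone `Γ = {x₁₄₅, x₂₄₅, x₃₄₅}` (`n = 5`)**: `I_{℘,Γ}` is the pre-image of the prime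
ideal `I₂` of `2 × 2` minors (Bruns–Herzog 7.3.6 via the tree), hence prime, hence `𝔽[x]/I_{℘,Γ}` is a domain — the
typed J1 hypothesis `ZGammaIntegral` holds here.
[cite: Hu2025, Lem. 7.3 C57L80 «Assume that Z_Γ is integral»; p.129 (unrefereed manuscript under adjudication — kernel support on a toy instance of the typed carriers, nothing of the manuscript asserted)] -/
theorem zGammaIntegral_segre : ZGammaIntegral 𝔉 (Γs : Set (Fin 9)) := by
  unfold ZGammaIntegral GammaSchemeRing
  haveI : (twoMinorIdeal ℚ 3).IsPrime := isPrime_twoMinorIdeal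
  haveI : Is.IsPrime := by
    rw [gammaWpIdeal_eq_comap]
    exact Ideal.IsPrime.comap _
  exact (Ideal.Quotient.isDomain_iff_prime Is).mpr inferInstance

/-- No variable of the generic matrix lies in `I₂` (its Segre image `u·t_j` / `v·t_j` is non-zero).
[cite: BrunsHerzog1998, proof of Thm. 7.3.6 (r = 1) (via the tree; used here only for the toy)] -/
theorem X_notMem_twoMinorIdeal (k : Fin (3 + 3)) : (X k : MvPolynomial (Fin (3 + 3)) ℚ) ∉ twoMinorIdeal ℚ 3 := by
  intro hk
  have h0 : segreMap ℚ 3 (X k) = 0 := twoMinorIdeal_le_ker hk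
  have hne : segre ℚ 3 k ≠ 0 := by
    fin_cases k <;> simp [segre, Fin.append, Fin.addCases, X_ne_zero]
  exact hne (by simpa [segreMap] using h0)

/-- **Which variables vanish on the Segre-cone `Z_Γ`: exactly those of `Γ`** (`x_y ∈ I_{℘,Γ} ⟺ y ∈ Γ`).
[cite: Hu2025, Lem. 7.3 (1) C57L127–L129 / proof C57L151; p.130 (unrefereed manuscript under adjudication — kernel support on a toy instance, nothing asserted)] -/
theorem X_mem_Is_iff (y : Fin 9) : (X y : R) ∈ Is ↔ y ∈ Γs := by
  constructor
  · intro hy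
    rw [gammaWpIdeal_eq_comap, Ideal.mem_comap] at hy
    by_contra hne
    have hy' : ¬ (y = 4 ∨ y = 7 ∨ y = 8) := by simpa [Γs] using hne
    fin_cases y <;> simp_all [φs, gs, X_notMem_twoMinorIdeal]
  · exact X_mem_Is

/-- The `k = 0` data of C57L144–L151 for the Segre-cone `Γ`: `Z = Z† := Z_Γ` on `𝐔`, `Γ̃⁰_𝐔 := Γ`, `Γ̃¹ = ∅`.
[cite: Hu2025, Lem. 7.3 proof C57L144–L151; p.130 (unrefereed manuscript under adjudication — kernel support on a toy instance, nothing asserted)] -/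
def Ds : GammaTransformChart (Fin 9) R := ⟨Is, Is, Γs, ∅⟩

/-- Item (1) at `k = 0` for the Segre-cone `Γ`. [cite: Hu2025, Lem. 7.3 (1) / proof C57L144–L153; p.130 (unrefereed manuscript under adjudication — kernel support on a toy instance, nothing asserted)] -/
theorem definedBy_Ds : Ds.DefinedBy X X rels := by
  show Ds.zIdeal = _
  simp only [Ds, Finset.coe_empty, Set.image_empty, Set.union_empty, Ideal.span_union]
  rfl

/-- **For the Segre-cone `Γ` the `k = 0` data `Γ̃⁰_𝐔 := Γ` DOES satisfy the maximality clause** (both claim readings;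
`gamma0Sat = Γ`) — in contrast with `Γ = {x₁₂₄, x₁₃₄}` (`Lem73BaseToy.not_gamma0Maximal_D0`).
[cite: Hu2025, Lem. 7.3 (1) C57L127–L129 / proof C57L151–L153; p.130 (unrefereed manuscript under adjudication — kernel fact about the typed reading on a toy instance, nothing of the manuscript asserted or denied)] -/
theorem gamma0Maximal_segre : Ds.Gamma0Maximal X X rels := by
  rw [gamma0Maximal_iff Ds definedBy_Ds]
  intro y hy
  exact (X_mem_Is_iff y).mp hy

/-- Hence `Lem7_3_1max` holds for the Segre-cone `k = 0` data (any `hInt`). [cite: Hu2025, Lem. 7.3 (1) C57L127–L129; p.130 (unrefereed manuscript under adjudication — kernel support on a toy instance, nothing asserted)] -/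
theorem lem7_3_1max_Ds (hInt : Prop) : Lem7_3_1max hInt X rels Ds := fun _ _ => gamma0Maximal_segre

end SegreConeToy

end Literature.AlgebraicGeometry.Hu2025.Statements.S07GammaSchemes

end

/-!
# Hu 2025 (arXiv:2507.21400v1) §7.1–§7.2 on the toy chart `n = 5`, `m = (123)`: a `Γ` whose Γ-scheme is NOT integral —
# `Γ = {x₁₄₅, x₂₄₅}` — i.e. a FALSE instance of the typed J1 hypothesis `ZGammaIntegral` (row 109, `R109aGamma.lean`)

**Honest framing (D-0012/D-0089).** A kernel fact about the TYPED carrier on ONE toy instance; it takes no side on the manuscript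
[Hu2025] (arXiv:2507.21400v1, `paper:arxiv-2507.21400`, UNREFEREED, under adjudication at rung M-Hu-min of the campaign
`res-hironaka`), whose Lemmas 7.3–7.5 / Thm 8.5 ASSUME «Z_Γ is integral» — a false instance of a hypothesis refutes nothing; it
shows the hypothesis has content already at `n = 5` (the index record `Hu2025/GammaSchemeNotIntegral*.lean` does this for matroid
sets `Γ_d` at `n = 9, 15`; the present `Γ` is not claimed to be a `Γ_d`). Provenance: res-type-016 (typer of record of row 109).
Same nine variables and `𝔉 = {F̄₁, F̄₂, F̄₃}` as `Lem73BaseMaximality.lean`.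
* `X0_mul_minor_mem` — `x₁₂₄ · (x₁₃₄x₂₃₅ − x₂₃₄x₁₃₅) ∈ I_{℘,Γ}` while `X0_notMem`, `minor_notMem` — neither factor does
  (two explicit points of `Z_Γ`); hence `not_isPrime` and **`not_zGammaIntegral`**: `¬ ZGammaIntegral 𝔉 {x₁₄₅, x₂₄₅}`
  (geometrically: `Z_Γ = {rank [[x₁₂₄,x₁₃₄,x₂₃₄],[x₁₂₅,x₁₃₅,x₂₃₅]] ≤ 1} ∪ {x₁₂₄ = x₁₂₅ = 0}`, two components).

## References
* [Hu2025] Y. Hu, arXiv:2507.21400v1 (2025), Def. 7.1 C57L9–L24 (p.128), Lem. 7.3 C57L80 «Assume that Z_Γ is integral» (p.129) —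
  loci of the typed definitions only (unrefereed manuscript under adjudication).
-/

noncomputable section

namespace Literature.AlgebraicGeometry.Hu2025.Statements.S07GammaSchemes

namespace Lem73BaseToy

open MvPolynomial

/-- `Γ = {x₁₄₅, x₂₄₅}` (indices `4, 7`). [cite: Hu2025, Def. 7.1 C57L9–L24; p.128 (unrefereed manuscript under adjudication — kernel support on a toy instance, nothing of the manuscript asserted)] -/
def Γ2 : Finset (Fin 9) := {4, 7}

/-- `I_{℘,Γ}` for `Γ = {x₁₄₅, x₂₄₅}`. [cite: Hu2025, Def. 7.1 C57L14–L21; p.128 (unrefereed manuscript under adjudication — kernel support on a toy instance, nothing asserted)] -/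
abbrev I2 : Ideal R := gammaWpIdeal 𝔉 (Γ2 : Set (Fin 9))

/-- The minor `x₁₃₄x₂₃₅ − x₂₃₄x₁₃₅` (= `x₃₄₅ − F̄₃`). [cite: Hu2025, Def. 3.4 C18L25; p.39 (unrefereed manuscript under adjudication — kernel support on a toy instance, nothing asserted)] -/
def minor12 : R := X 2 * X 6 - X 5 * X 3

/-- `x₁₄₅ ∈ I_{℘,Γ}`. [cite: Hu2025, Def. 7.1 C57L14–L21; p.128 (unrefereed manuscript under adjudication — kernel support on a toy instance, nothing asserted)] -/
theorem X4_mem_I2 : (X 4 : R) ∈ I2 := Ideal.mem_sup_left (Ideal.subset_span ⟨4, by simp [Γ2], rfl⟩)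
/-- `x₂₄₅ ∈ I_{℘,Γ}`. [cite: Hu2025, Def. 7.1 C57L14–L21; p.128 (unrefereed manuscript under adjudication — kernel support on a toy instance, nothing asserted)] -/
theorem X7_mem_I2 : (X 7 : R) ∈ I2 := Ideal.mem_sup_left (Ideal.subset_span ⟨7, by simp [Γ2], rfl⟩)
/-- `F̄ⱼ ∈ I_{℘,Γ}`. [cite: Hu2025, Def. 7.1 C57L14–L21; p.128 (unrefereed manuscript under adjudication — kernel support on a toy instance, nothing asserted)] -/
theorem rels_mem_I2 (j : Fin 3) : rels j ∈ I2 := Ideal.mem_sup_right (Ideal.subset_span ⟨j, rfl⟩)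

/-- `F̄₁ ∈ I_{℘,Γ}`. [cite: Hu2025, Def. 7.1 C57L14–L21; p.128 (unrefereed manuscript under adjudication — kernel support on a toy instance, nothing asserted)] -/
theorem F1_mem_I2 : F1 ∈ I2 := by simpa [rels] using rels_mem_I2 0
/-- `F̄₂ ∈ I_{℘,Γ}`. [cite: Hu2025, Def. 7.1 C57L14–L21; p.128 (unrefereed manuscript under adjudication — kernel support on a toy instance, nothing asserted)] -/
theorem F2_mem_I2 : F2 ∈ I2 := by simpa [rels] using rels_mem_I2 1

/-- **`x₁₂₄ · (x₁₃₄x₂₃₅ − x₂₃₄x₁₃₅) ∈ I_{℘,Γ}`**: `x₁₂₄·minor = x₁₃₄·(x₂₄₅ − F̄₂) − x₂₃₄·(x₁₄₅ − F̄₁)`.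
[cite: Hu2025, Def. 7.1 C57L14–L21; p.128 (unrefereed manuscript under adjudication — kernel support on a toy instance, nothing asserted)] -/
theorem X0_mul_minor_mem : (X 0 : R) * minor12 ∈ I2 := by
  have key : (X 0 : R) * minor12 = X 2 * (X 7 - F2) - X 5 * (X 4 - F1) := by
    simp only [minor12, F1, F2]
    ring
  rw [key]
  exact I2.sub_mem (I2.mul_mem_left _ (I2.sub_mem X7_mem_I2 F2_mem_I2))
    (I2.mul_mem_left _ (I2.sub_mem X4_mem_I2 F1_mem_I2))

/-- A point of `Z_Γ` (all six matrix entries `1`, `x₁₄₅ = x₂₄₅ = x₃₄₅ = 0`) at which `x₁₂₄ ≠ 0`. [cite: Hu2025, Def. 7.1 C57L19–L24; p.128 (unrefereed manuscript under adjudication — kernel support on a toy instance, nothing asserted)] -/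
def pt1 (i : Fin 9) : ℚ := if i = 4 ∨ i = 7 ∨ i = 8 then 0 else 1

/-- A point of `Z_Γ` (`x₁₂₄ = x₁₂₅ = 0`, `x₁₃₄ = x₂₃₅ = x₃₄₅ = 1`, rest `0`) at which the minor is `≠ 0`. [cite: Hu2025, Def. 7.1 C57L19–L24; p.128 (unrefereed manuscript under adjudication — kernel support on a toy instance, nothing asserted)] -/
def pt2 (i : Fin 9) : ℚ := if i = 2 ∨ i = 6 ∨ i = 8 then 1 else 0

/-- Evaluation at a point kills `I_{℘,Γ}` as soon as it kills the generators. [cite: Hu2025, Def. 7.1 C57L14–L21; p.128 (unrefereed manuscript under adjudication — kernel support on a toy instance, nothing asserted)] -/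
theorem I2_le_ker_eval (v : Fin 9 → ℚ) (h4 : v 4 = 0) (h7 : v 7 = 0) (hF : ∀ j, MvPolynomial.eval v (rels j) = 0) :
    I2 ≤ RingHom.ker (MvPolynomial.eval v) := by
  apply sup_le
  · rw [gammaIdeal, Ideal.span_le]
    rintro _ ⟨y, hy, rfl⟩
    have hy' : y = 4 ∨ y = 7 := by simpa [Γ2] using hy
    rcases hy' with rfl | rfl <;> simp [RingHom.mem_ker, h4, h7]
  · rw [Ideal.span_le]
    rintro _ ⟨j, rfl⟩
    exact hF j

/-- `x₁₂₄ ∉ I_{℘,Γ}`. [cite: Hu2025, Def. 7.1 C57L14–L24; p.128 (unrefereed manuscript under adjudication — kernel support on a toy instance, nothing asserted)] -/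
theorem X0_notMem : (X 0 : R) ∉ I2 := by
  intro h
  have hle := I2_le_ker_eval pt1 (by simp [pt1]) (by simp [pt1])
    (by intro j; fin_cases j <;> simp [rels, F1, F2, F3, pt1])
  have := hle h
  simp [RingHom.mem_ker, pt1] at this

/-- `x₁₃₄x₂₃₅ − x₂₃₄x₁₃₅ ∉ I_{℘,Γ}`. [cite: Hu2025, Def. 7.1 C57L14–L24; p.128 (unrefereed manuscript under adjudication — kernel support on a toy instance, nothing asserted)] -/
theorem minor_notMem : minor12 ∉ I2 := by
  intro h
  have hle := I2_le_ker_eval pt2 (by simp [pt2]) (by simp [pt2])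
    (by intro j; fin_cases j <;> simp [rels, F1, F2, F3, pt2])
  have := hle h
  simp [RingHom.mem_ker, pt2, minor12] at this

/-- `I_{℘,Γ}` is not prime for `Γ = {x₁₄₅, x₂₄₅}`. [cite: Hu2025, Def. 7.1 C57L14–L24; p.128 (unrefereed manuscript under adjudication — kernel support on a toy instance, nothing asserted)] -/
theorem not_isPrime_I2 : ¬ I2.IsPrime := fun hp =>
  (hp.mem_or_mem X0_mul_minor_mem).elim X0_notMem minor_notMem

/-- **`Z_Γ` is NOT integral for `Γ = {x₁₄₅, x₂₄₅}` (`n = 5`)**: a false instance of the typed hypothesis `ZGammaIntegral` — the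
J1 hypothesis «Assume that Z_Γ is integral» has content at `n = 5`. (A false instance of a HYPOTHESIS refutes nothing in the
manuscript.) [cite: Hu2025, Lem. 7.3 C57L80 «Assume that Z_Γ is integral»; p.129 (unrefereed manuscript under adjudication — kernel fact about the typed carrier on a toy instance, nothing of the manuscript asserted or denied)] -/
theorem not_zGammaIntegral : ¬ ZGammaIntegral 𝔉 (Γ2 : Set (Fin 9)) := by
  intro h
  unfold ZGammaIntegral GammaSchemeRing at h
  haveI : IsDomain (R ⧸ I2) := h
  exact not_isPrime_I2 ((Ideal.Quotient.isDomain_iff_prime I2).mp inferInstance)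

/-! ### A second non-integral instance: `Γ = {x₁₂₄, x₁₄₅}` (`I_{℘,Γ} ∋ x₁₃₄·x₁₂₅` with neither factor in it) -/

/-- `Γ = {x₁₂₄, x₁₄₅}` (indices `0, 4`). [cite: Hu2025, Def. 7.1 C57L14–L24 / Lem. 7.3 C57L80; p.128–129 (unrefereed manuscript under adjudication — kernel support on a toy instance, nothing of the manuscript asserted)] -/
def Γ3 : Finset (Fin 9) := {0, 4}

/-- `I_{℘,Γ}` for `Γ = {x₁₂₄, x₁₄₅}`. [cite: Hu2025, Def. 7.1 C57L14–L24 / Lem. 7.3 C57L80; p.128–129 (unrefereed manuscript under adjudication — kernel support on a toy instance, nothing of the manuscript asserted)] -/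
abbrev I3 : Ideal R := gammaWpIdeal 𝔉 (Γ3 : Set (Fin 9))

/-- `F̄ⱼ ∈ I_{℘,Γ}`. [cite: Hu2025, Def. 7.1 C57L14–L24 / Lem. 7.3 C57L80; p.128–129 (unrefereed manuscript under adjudication — kernel support on a toy instance, nothing of the manuscript asserted)] -/
theorem rels_mem_I3 (j : Fin 3) : rels j ∈ I3 := Ideal.mem_sup_right (Ideal.subset_span ⟨j, rfl⟩)

/-- **`x₁₃₄ · x₁₂₅ ∈ I_{℘,Γ}`** (`= F̄₁ − x₁₄₅ + x₁₂₄x₁₃₅`). [cite: Hu2025, Def. 7.1 C57L14–L24 / Lem. 7.3 C57L80; p.128–129 (unrefereed manuscript under adjudication — kernel support on a toy instance, nothing of the manuscript asserted)] -/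
theorem X2_mul_X1_mem_I3 : (X 2 * X 1 : R) ∈ I3 := by
  have h0 : (X 0 : R) ∈ I3 := Ideal.mem_sup_left (Ideal.subset_span ⟨0, by simp [Γ3], rfl⟩)
  have h4 : (X 4 : R) ∈ I3 := Ideal.mem_sup_left (Ideal.subset_span ⟨4, by simp [Γ3], rfl⟩)
  have hF1 : F1 ∈ I3 := by simpa [rels] using rels_mem_I3 0
  have : (X 2 * X 1 : R) = F1 - X 4 + X 0 * X 3 := by simp only [F1]; ring
  rw [this]
  exact I3.add_mem (I3.sub_mem hF1 h4) (I3.mul_mem_right _ h0)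

/-- Evaluation at a point kills `I_{℘,Γ}` as soon as it kills the generators. [cite: Hu2025, Def. 7.1 C57L14–L24 / Lem. 7.3 C57L80; p.128–129 (unrefereed manuscript under adjudication — kernel support on a toy instance, nothing of the manuscript asserted)] -/
theorem I3_le_ker_eval (v : Fin 9 → ℚ) (h0 : v 0 = 0) (h4 : v 4 = 0) (hF : ∀ j, MvPolynomial.eval v (rels j) = 0) :
    I3 ≤ RingHom.ker (MvPolynomial.eval v) := by
  apply sup_le
  · rw [gammaIdeal, Ideal.span_le]
    rintro _ ⟨y, hy, rfl⟩
    have hy' : y = 0 ∨ y = 4 := by simpa [Γ3] using hy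
    rcases hy' with rfl | rfl <;> simp [RingHom.mem_ker, h0, h4]
  · rw [Ideal.span_le]
    rintro _ ⟨j, rfl⟩
    exact hF j

/-- A point of `Z_Γ` with `x₁₃₄ ≠ 0`: `x₁₃₄ = 1`, everything else `0`. [cite: Hu2025, Def. 7.1 C57L14–L24 / Lem. 7.3 C57L80; p.128–129 (unrefereed manuscript under adjudication — kernel support on a toy instance, nothing of the manuscript asserted)] -/
def pt3 (i : Fin 9) : ℚ := if i = 2 then 1 else 0

/-- A point of `Z_Γ` with `x₁₂₅ ≠ 0`: `x₁₂₅ = 1`, everything else `0`. [cite: Hu2025, Def. 7.1 C57L14–L24 / Lem. 7.3 C57L80; p.128–129 (unrefereed manuscript under adjudication — kernel support on a toy instance, nothing of the manuscript asserted)] -/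
def pt4 (i : Fin 9) : ℚ := if i = 1 then 1 else 0

/-- `x₁₃₄ ∉ I_{℘,Γ}`. [cite: Hu2025, Def. 7.1 C57L14–L24 / Lem. 7.3 C57L80; p.128–129 (unrefereed manuscript under adjudication — kernel support on a toy instance, nothing of the manuscript asserted)] -/
theorem X2_notMem_I3 : (X 2 : R) ∉ I3 := by
  intro h
  have hle := I3_le_ker_eval pt3 (by simp [pt3]) (by simp [pt3]) (by intro j; fin_cases j <;> simp [rels, F1, F2, F3, pt3])
  have := hle h
  simp [RingHom.mem_ker, pt3] at this

/-- `x₁₂₅ ∉ I_{℘,Γ}`. [cite: Hu2025, Def. 7.1 C57L14–L24 / Lem. 7.3 C57L80; p.128–129 (unrefereed manuscript under adjudication — kernel support on a toy instance, nothing of the manuscript asserted)] -/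
theorem X1_notMem_I3 : (X 1 : R) ∉ I3 := by
  intro h
  have hle := I3_le_ker_eval pt4 (by simp [pt4]) (by simp [pt4]) (by intro j; fin_cases j <;> simp [rels, F1, F2, F3, pt4])
  have := hle h
  simp [RingHom.mem_ker, pt4] at this

/-- **`Z_Γ` is NOT integral for `Γ = {x₁₂₄, x₁₄₅}` (`n = 5`)** — a second false instance of the typed hypothesis `ZGammaIntegral`
(refutes nothing in the manuscript, which ASSUMES integrality). [cite: Hu2025, Def. 7.1 C57L14–L24 / Lem. 7.3 C57L80; p.128–129 (unrefereed manuscript under adjudication — kernel support on a toy instance, nothing of the manuscript asserted)] -/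
theorem not_zGammaIntegral_124_145 : ¬ ZGammaIntegral 𝔉 (Γ3 : Set (Fin 9)) := by
  intro h
  unfold ZGammaIntegral GammaSchemeRing at h
  haveI : IsDomain (R ⧸ I3) := h
  have hp : I3.IsPrime := (Ideal.Quotient.isDomain_iff_prime I3).mp inferInstance
  exact (hp.mem_or_mem X2_mul_X1_mem_I3).elim X2_notMem_I3 X1_notMem_I3

end Lem73BaseToy

end Literature.AlgebraicGeometry.Hu2025.Statements.S07GammaSchemes

end
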